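import Summits.QuantumFields.YangMills.Theorems.PoincareLipschitzMesoscopicConcentrationLOfMesoscopicBox
import Summits.QuantumFields.YangMills.Theorems.CurvaturePoincareStubLocalBoxExpMoment
import Summits.QuantumFields.YangMills.Theorems.PoincareLipschitzMesoscopicConcentrationLSqrtPinnedTail
import Literature.MathematicalPhysics.QuantumFieldTheory.Balaban1983to89.T4AxialGaugeSmallField
import HarnessLib

/-!
# LINE 30 «CurvaturePoincare» — THE LARGE-DEVIATION REGIME OF K1′ AND THE K1 FACE «23532 ⟸ NP + MD», AS TREE THEOREMS (composition port)

Cell `ym3-torus` (YM ladder rung R3 = continuum SU(2) Yang–Mills on T³ — a RUNG, NOT d = 4, NOT infinite volume, NOT a mass gap, NOT Clay).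
Width seat `ym3-torus-px10` g8 (K30-KNIT); `--supports stmt-QuantumFields-23532 --as helper`; theorems only, definition-free, DEFAULT heartbeats.
THEOREMS-SIDE PORT of §2 of ideator `ym-r3-idea-2` g16's registered skeleton `Cruxes/HistoryTailL/Lines/curvature_poincare.lean` (sha16 e95b7bfb5ac8bc91,
registered on stmt-QuantumFields-23532 2026-08-29 19:26:09Z) over the two LANDED stubs
* LM ✓p740923 `…CurvaturePoincareStubLocalBoxExpMoment.stub_localBoxExpMoment` (seat ym-ust-19936-w3 g17) — the LOCAL exponential moment and mean of the box
  action `Σ_{p∈box} dist₁(U(∂p))²` at coupling `β_K/24`;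
* B♯ ✓p740627 `…PoincareLipschitzMesoscopicConcentrationLSqrtPinnedTail.stub_sqrtPinnedTail` (seat ym-line-cst-p1 g33) — √-pinned measure bookkeeping;
with the third stub NP `stub_curvaturePinning` (the curvature/Poincaré pinning `|f(U) − f(𝟙)| ≤ Λ·C·n·‖dist₁(U(∂·))‖_{ℓ²(box)}`; pen ym3-torus-px19 g9,
«averaged axial gauges») DISPLAYED as the hypothesis `hNP` (registered text verbatim), and the residual MD `stub_moderateDeviationResidual` (the Gaussian window
`17·L³ < n ≤ β_K ∧ β_K r² ≤ C_th·Λ²·n⁵`; XL, organ-adjacent, 0 seats) displayed as `hMD`.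

RESULTS (ns `…Theorems.CurvaturePoincareLargeDeviationOfStubs`).
* §1 three lines of real arithmetic (the regime inequality and the exponent comparison of the skeleton's kernel, split off so that everything
  elaborates at default heartbeats — the skeleton's kernel carries `maxHeartbeats 1600000`).
* `largeDeviation_of (hNP) (hLM) (hB)` — the skeleton's kernel VERBATIM in statement: for every `L` there are `C_th > 0`, `Cc ≥ 0`, `cc > 0`, `γ₁ ∈ (0,1]`
  with `μ_K{r ≤ f − ∫f} ≤ Cc·exp(−cc·β_K r²/(n²Λ²))` for ALL box sides `1 ≤ n ≤ β_K` in the LARGE-DEVIATION regime `C_th·Λ²·n⁵ ≤ β_K·r²`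
  (constants `C_th = 192·E₁·C² + 1`, `Cc = 1`, `cc = 1/(192·C²)`).
* `largeDeviation_of_NP (hNP)` — the same with LM and B♯ DISCHARGED by the landed theorems (one displayed row: NP).
* `mesoscopicResidual_of (hlarge) (hmod)` — GLUE: large deviations + the moderate window ⟹ the v1.1 mesoscopic residual text (R) (1173 chars, = LINE 23's
  `stub_mesoscopicBoxConcentration` = the row `hR` of the K1 face ✓p740183), max/min of constants.
* ★ `mesoscopicConcentrationL_of_NP_MD (hNP) (hMD) : Summit.QuantumFields.YangMills.Theses.PoincareLipschitz.MesoscopicConcentrationL` — the K1 FACE over LINE 30: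
  crux 23532 BY NAME from the two ACTIVE registered stubs NP and MD only (via ✓p740183 `mesoscopicConcentrationL_of_mesoscopicBox` and the tree's bounded-box
  rung ✓`PoincareLipschitzStubBoundedBoxConcentration`).  When NP lands, `hNP` is discharged by name and the face becomes «23532 ⟸ MD alone» (one line).

HONEST SCOPE.  Bookkeeping/display over landed theorems.  NOTHING of NP, of MD (the Gaussian-concentration window — the whole remaining content of K1), of
`HistoryTailL` (19936), 23083, EX (19200), 20520, any rung or summit statement is proved here.  Sorry-free, axioms standard.

References: T. Bałaban, Commun. Math. Phys. **102** (1985) 255–275 [Balaban1985UV3] ((3) p.256, (7) p.257).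
-/

open scoped BigOperators
open MeasureTheory
open Literature.MathematicalPhysics.QuantumFieldTheory.Balaban1983to89
open Literature.MathematicalPhysics.QuantumFieldTheory.Balaban1983to89.T3ContinuumYM3Torus
open Literature.MathematicalPhysics.QuantumFieldTheory.Balaban1983to89.T3UnitScaleTilt
open Literature.MathematicalPhysics.QuantumFieldTheory.Balaban1983to89.T3UnitLawDensityEML (ℰp)
open Literature.MathematicalPhysics.QuantumFieldTheory.Balaban1983to89.T4AxialGaugeSmallField (boxPlaqs castSite axialGauge)

namespace Summit.QuantumFields.YangMills.Theorems.CurvaturePoincareLargeDeviationOfStubs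

/-! ## §1 Real arithmetic of the large-deviation kernel (no measure, no lattice) -/

/-- REGIME: the threshold `(192·E₁·C² + 1)·Λ²·n⁵ ≤ β·r²` implies the √-bookkeeping regime `4·M²·m ≤ r²` with `M = Λ·C·n`, `m = E₁n³/β`. -/
theorem regime_of_threshold {E₁ C Λ n β r : ℝ} (hE₁ : 0 ≤ E₁) (hn : 0 ≤ n) (hβ : 0 < β)
    (hthr : (192 * E₁ * C ^ 2 + 1) * Λ ^ 2 * n ^ 5 ≤ β * r ^ 2) :
    4 * ((Λ * (C * n)) ^ 2 * (E₁ * n ^ 3 / β)) ≤ r ^ 2 := by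
  have h1 : (192 * E₁ * C ^ 2 + 1) * Λ ^ 2 * n ^ 5 / β ≤ r ^ 2 := by
    rw [div_le_iff₀ hβ]; linarith [hthr]
  have h2 : 4 * ((Λ * (C * n)) ^ 2 * (E₁ * n ^ 3 / β)) = (4 * E₁ * C ^ 2) * Λ ^ 2 * n ^ 5 / β := by
    field_simp
  rw [h2]
  refine le_trans ?_ h1
  have hΛn : 0 ≤ Λ ^ 2 * n ^ 5 := by positivity
  have hcoef : 4 * E₁ * C ^ 2 ≤ 192 * E₁ * C ^ 2 + 1 := by nlinarith [mul_nonneg hE₁ (sq_nonneg C)]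
  have hx : (4 * E₁ * C ^ 2) * (Λ ^ 2 * n ^ 5) ≤ (192 * E₁ * C ^ 2 + 1) * (Λ ^ 2 * n ^ 5) :=
    mul_le_mul_of_nonneg_right hcoef hΛn
  calc (4 * E₁ * C ^ 2) * Λ ^ 2 * n ^ 5 / β = (4 * E₁ * C ^ 2) * (Λ ^ 2 * n ^ 5) / β := by ring
  _ ≤ (192 * E₁ * C ^ 2 + 1) * (Λ ^ 2 * n ^ 5) / β := div_le_div_of_nonneg_right hx hβ.le
  _ = (192 * E₁ * C ^ 2 + 1) * Λ ^ 2 * n ^ 5 / β := by ring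

/-- The threshold is positive, so `r > 0` in the regime. -/
theorem pos_of_threshold {E₁ C Λ n β r : ℝ} (hE₁ : 0 ≤ E₁) (hC : 0 < C) (hΛ : 0 < Λ) (hn : 0 < n) (hr : 0 ≤ r)
    (hthr : (192 * E₁ * C ^ 2 + 1) * Λ ^ 2 * n ^ 5 ≤ β * r ^ 2) : 0 < r := by
  have hthr0 : 0 < (192 * E₁ * C ^ 2 + 1) * Λ ^ 2 * n ^ 5 := by positivity
  rcases lt_or_eq_of_le hr with h | h
  · exact h
  · exfalso; rw [← h] at hthr; simp at hthr; linarith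

/-- EXPONENT: in the regime, `A − t·r²/(4M²) ≤ −cc·β·r²/(n²Λ²)` with `A = E₁n³`, `t = β/24`, `M = Λ·C·n`, `cc = 1/(192C²)`. -/
theorem exponent_le_of_threshold {E₁ C Λ n β r : ℝ} (hC : 0 < C) (hΛ : 0 < Λ) (hn : 0 < n) (hβ : 0 < β)
    (hthr : (192 * E₁ * C ^ 2 + 1) * Λ ^ 2 * n ^ 5 ≤ β * r ^ 2) :
    E₁ * n ^ 3 + -(β / 24 * r ^ 2 / (4 * (Λ * (C * n)) ^ 2)) ≤ -(1 / (192 * C ^ 2) * β * r ^ 2 / (n ^ 2 * Λ ^ 2)) := by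
  have hn0 : n ≠ 0 := hn.ne'
  have hΛ0 : Λ ≠ 0 := hΛ.ne'
  have hC0 : C ≠ 0 := hC.ne'
  have hQ : (192 * E₁ * C ^ 2 + 1) * n ^ 3 / C ^ 2 ≤ β * r ^ 2 / (n ^ 2 * Λ ^ 2 * C ^ 2) := by
    have e : (192 * E₁ * C ^ 2 + 1) * n ^ 3 / C ^ 2 = (192 * E₁ * C ^ 2 + 1) * Λ ^ 2 * n ^ 5 / (n ^ 2 * Λ ^ 2 * C ^ 2) := by
      field_simp
    rw [e]
    exact div_le_div_of_nonneg_right hthr (by positivity)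
  have hE : E₁ * n ^ 3 ≤ β * r ^ 2 / (n ^ 2 * Λ ^ 2 * C ^ 2) / 192 := by
    have e : (192 * E₁ * C ^ 2 + 1) * n ^ 3 / C ^ 2 / 192 = E₁ * n ^ 3 + n ^ 3 / (192 * C ^ 2) := by
      field_simp
    have hpos : 0 ≤ n ^ 3 / (192 * C ^ 2) := by positivity
    have := div_le_div_of_nonneg_right hQ (by norm_num : (0 : ℝ) ≤ 192)
    rw [e] at this
    linarith
  have e1 : β / 24 * r ^ 2 / (4 * (Λ * (C * n)) ^ 2) = β * r ^ 2 / (n ^ 2 * Λ ^ 2 * C ^ 2) / 96 := by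
    field_simp
    ring
  have e2 : 1 / (192 * C ^ 2) * β * r ^ 2 / (n ^ 2 * Λ ^ 2) = β * r ^ 2 / (n ^ 2 * Λ ^ 2 * C ^ 2) / 192 := by
    field_simp
  rw [e1, e2]
  have hR0 : 0 ≤ β * r ^ 2 / (n ^ 2 * Λ ^ 2 * C ^ 2) := by positivity
  linarith

/-! ## §2 The large-deviation regime of K1′ (every box side `1 ≤ n ≤ β_K`), hypotheses displayed -/

open Classical in
/-- KERNEL (large deviations, every `n ≥ 1`), port of the skeleton's `largeDeviation_of`: NP `→` LM `→` B♯ `→` for every `L`, constants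
`C_th = 192·E₁·C² + 1`, `Cc = 1`, `cc = 1/(192·C²)`, `γ₁` of LM, and the crux's rate in the regime `C_th·Λ²·n⁵ ≤ β_K·r²`.  B♯ is applied with
`X = Σ_{p∈box} dist₁(U(∂p))²`, `g = f`, `g₁ = f(𝟙)`, `M = Λ·C·n`, `t = β_K/24`, `A = E₁n³`, `m = E₁n³/β_K`, `Xmax = 12(n+1)³`.
[cite: Balaban1985UV3, (3) p.256, (7) p.257] -/
theorem largeDeviation_of
    (hNP : ∃ C : ℝ, 0 < C ∧ ∀ (F : T3Family) (K n : ℕ) (x₀ : Site (F.P K) 0)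
      (f : GaugeField (F.P K) 0 (Matrix.specialUnitaryGroup (Fin 2) ℂ) → ℝ) (Λ : ℝ), 0 ≤ Λ → 1 ≤ n → 2 * n ≤ (F.P K).sitesPerDir 0 →
      GaugeField.GaugeInvariant f →
      (∀ U U' : GaugeField (F.P K) 0 (Matrix.specialUnitaryGroup (Fin 2) ℂ),
        (∀ b : PBond (F.P K) 0, (∀ k, (b.src k - x₀ k).val < n) → (∀ k, (b.tgt k - x₀ k).val < n) → U b = U' b) → f U = f U') →
      (∀ U U' : GaugeField (F.P K) 0 (Matrix.specialUnitaryGroup (Fin 2) ℂ),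
        |f U - f U'| ≤ Λ * Real.sqrt (∑ b : PBond (F.P K) 0, GaugeGroup.dist1 (U b * (U' b)⁻¹) ^ 2)) →
      ∀ U : GaugeField (F.P K) 0 (Matrix.specialUnitaryGroup (Fin 2) ℂ),
        |f U - f (fun _ => 1)| ≤ Λ * (C * (n : ℝ)) * Real.sqrt (∑ p ∈ Finset.univ.filter (fun p : Plaq (F.P K) 0 => p ∈ boxPlaqs (P := F.P K) (j := 0) (fun k => ((x₀ k).val : ℤ)) (fun k => ((x₀ k).val : ℤ) + ((n : ℤ) - 1))), GaugeGroup.dist1 (GaugeField.plaqHol U p) ^ 2))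
    (hLM : ∀ (L : ℕ), ∃ (E₁ : ℝ), 0 ≤ E₁ ∧ ∃ γ₁ : ℝ, 0 < γ₁ ∧ γ₁ ≤ 1 ∧
      ∀ (F : T3Family) (γ : ℝ), F.L = L → 0 < γ → γ ≤ γ₁ → ∀ (K n : ℕ) (x₀ : Site (F.P K) 0), 1 ≤ n → 2 * n ≤ (F.P K).sitesPerDir 0 →
        (Measurable fun U : GaugeField (F.P K) 0 (Matrix.specialUnitaryGroup (Fin 2) ℂ) => (∑ p ∈ Finset.univ.filter (fun p : Plaq (F.P K) 0 => p ∈ boxPlaqs (P := F.P K) (j := 0) (fun k => ((x₀ k).val : ℤ)) (fun k => ((x₀ k).val : ℤ) + ((n : ℤ) - 1))), GaugeGroup.dist1 (GaugeField.plaqHol U p) ^ 2)) ∧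
        (∀ U : GaugeField (F.P K) 0 (Matrix.specialUnitaryGroup (Fin 2) ℂ), 0 ≤ (∑ p ∈ Finset.univ.filter (fun p : Plaq (F.P K) 0 => p ∈ boxPlaqs (P := F.P K) (j := 0) (fun k => ((x₀ k).val : ℤ)) (fun k => ((x₀ k).val : ℤ) + ((n : ℤ) - 1))), GaugeGroup.dist1 (GaugeField.plaqHol U p) ^ 2) ∧ (∑ p ∈ Finset.univ.filter (fun p : Plaq (F.P K) 0 => p ∈ boxPlaqs (P := F.P K) (j := 0) (fun k => ((x₀ k).val : ℤ)) (fun k => ((x₀ k).val : ℤ) + ((n : ℤ) - 1))), GaugeGroup.dist1 (GaugeField.plaqHol U p) ^ 2) ≤ 12 * ((n : ℝ) + 1) ^ 3) ∧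
        ∫ U, Real.exp ((F.scheme ℰp γ).β K / 24 * (∑ p ∈ Finset.univ.filter (fun p : Plaq (F.P K) 0 => p ∈ boxPlaqs (P := F.P K) (j := 0) (fun k => ((x₀ k).val : ℤ)) (fun k => ((x₀ k).val : ℤ) + ((n : ℤ) - 1))), GaugeGroup.dist1 (GaugeField.plaqHol U p) ^ 2)) ∂(gibbsK F ℰp γ K) ≤ Real.exp (E₁ * (n : ℝ) ^ 3) ∧
        ∫ U, (∑ p ∈ Finset.univ.filter (fun p : Plaq (F.P K) 0 => p ∈ boxPlaqs (P := F.P K) (j := 0) (fun k => ((x₀ k).val : ℤ)) (fun k => ((x₀ k).val : ℤ) + ((n : ℤ) - 1))), GaugeGroup.dist1 (GaugeField.plaqHol U p) ^ 2) ∂(gibbsK F ℰp γ K) ≤ E₁ * (n : ℝ) ^ 3 / (F.scheme ℰp γ).β K)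
    (hB : ∀ (F : T3Family) (γ : ℝ), 0 < γ → ∀ (K : ℕ) (X g : GaugeField (F.P K) 0 (Matrix.specialUnitaryGroup (Fin 2) ℂ) → ℝ) (g₁ M t A m Xmax : ℝ),
      Measurable g → Measurable X → 0 ≤ M → 0 < t → 0 ≤ m → (∀ U, 0 ≤ X U) → (∀ U, X U ≤ Xmax) →
      (∀ U, |g U - g₁| ≤ M * Real.sqrt (X U)) →
      ∫ U, Real.exp (t * X U) ∂(gibbsK F ℰp γ K) ≤ Real.exp A →
      ∫ U, X U ∂(gibbsK F ℰp γ K) ≤ m →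
      ∀ r : ℝ, 0 < r → 4 * (M ^ 2 * m) ≤ r ^ 2 →
        (gibbsK F ℰp γ K).real {U | r ≤ g U - ∫ V, g V ∂(gibbsK F ℰp γ K)} ≤ Real.exp A * Real.exp (-(t * r ^ 2 / (4 * M ^ 2)))) :
        open Literature.MathematicalPhysics.QuantumFieldTheory.Balaban1983to89 Literature.MathematicalPhysics.QuantumFieldTheory.Balaban1983to89.T3ContinuumYM3Torus in ∀ (L : ℕ), ∃ (Cth : ℝ), 0 < Cth ∧ ∃ (Cc cc : ℝ), 0 ≤ Cc ∧ 0 < cc ∧ ∃ γ₁ : ℝ, 0 < γ₁ ∧ γ₁ ≤ 1 ∧ ∀ (F : T3Family) (γ : ℝ), F.L = L → 0 < γ → γ ≤ γ₁ → ∀ (K n : ℕ), 1 ≤ n → (n : ℝ) ≤ (F.scheme T3UnitLawDensityEML.ℰp γ).β K → 2 * n ≤ (F.P K).sitesPerDir 0 → ∀ (x₀ : Site (F.P K) 0) (f : GaugeField (F.P K) 0 (Matrix.specialUnitaryGroup (Fin 2) ℂ) → ℝ) (Λ : ℝ), 0 < Λ → Measurable f → GaugeField.GaugeInvariant f → (∀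 U U' : GaugeField (F.P K) 0 (Matrix.specialUnitaryGroup (Fin 2) ℂ), (∀ b : PBond (F.P K) 0, (∀ k, (b.src k - x₀ k).val < n) → (∀ k, (b.tgt k - x₀ k).val < n) → U b = U' b) → f U = f U') → (∀ U U' : GaugeField (F.P K) 0 (Matrix.specialUnitaryGroup (Fin 2) ℂ), |f U - f U'| ≤ Λ * Real.sqrt (∑ b : PBond (F.P K) 0, GaugeGroup.dist1 (U b * (U' b)⁻¹) ^ 2)) → ∀ r : ℝ, 0 ≤ r → Cth * Λ ^ 2 * (n : ℝ) ^ 5 ≤ (F.scheme T3UnitLawDensityEML.ℰp γ).β K * r ^ 2 → (T3UnitScaleTilt.gibbsK F T3UnitLawDensityEML.ℰp γ K).real {U | r ≤ f U - ∫ V, f V ∂(T3UnitScaleTilt.gibbsK F T3UnitLawDensityEML.ℰp γ K)} ≤ Cc * Real.exp (-(cc * (F.scheme T3UnitLawDensityEML.ℰp γ).β K * r ^ 2 / ((n : ℝ) ^ 2 * Λ ^ 2))) := by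
  obtain ⟨C, hC, HNP⟩ := hNP
  intro L
  obtain ⟨E₁, hE₁, γa, hγa, hγa1, HLM⟩ := hLM L
  refine ⟨192 * E₁ * C ^ 2 + 1, by positivity, 1, 1 / (192 * C ^ 2), zero_le_one, by positivity, γa, hγa, hγa1, ?_⟩
  intro F γ hFL hγ hγle K n hn1 hnβ h2n x₀ f Λ hΛ hfm hfG hloc hlip r hr hthr
  have hn1r : (1 : ℝ) ≤ (n : ℝ) := by exact_mod_cast hn1
  have hn0 : (0 : ℝ) < (n : ℝ) := by linarith
  have hβ : 0 < (F.scheme ℰp γ).β K := by linarith [hn1r.trans hnβ]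
  obtain ⟨hXm, hXrng, hXexp, hXmean⟩ := HLM F γ hFL hγ hγle K n x₀ hn1 h2n
  have hpin := HNP F K n x₀ f Λ hΛ.le hn1 h2n hfG hloc hlip
  -- the regime: 4·M²·m ≤ r², and r > 0
  have hreg : 4 * ((Λ * (C * (n : ℝ))) ^ 2 * (E₁ * (n : ℝ) ^ 3 / (F.scheme ℰp γ).β K)) ≤ r ^ 2 :=
    regime_of_threshold hE₁ hn0.le hβ hthr
  have hr0 : 0 < r := pos_of_threshold hE₁ hC hΛ hn0 hr hthr
  have key := hB F γ hγ K _ f (f (fun _ => 1)) (Λ * (C * (n : ℝ))) ((F.scheme ℰp γ).β K / 24) (E₁ * (n : ℝ) ^ 3)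
    (E₁ * (n : ℝ) ^ 3 / (F.scheme ℰp γ).β K) (12 * ((n : ℝ) + 1) ^ 3) hfm hXm (by positivity) (by positivity) (by positivity)
    (fun U => (hXrng U).1) (fun U => (hXrng U).2) hpin hXexp hXmean r hr0 hreg
  refine key.trans ?_
  rw [← Real.exp_add, one_mul, Real.exp_le_exp]
  exact exponent_le_of_threshold hC hΛ hn0 hβ hthr

open Classical in
/-- The large-deviation regime with LM and B♯ DISCHARGED by the landed theorems ✓p740923 and ✓p740627 — ONE displayed row: NP (`stub_curvaturePinning`,
registered text verbatim). -/
theorem largeDeviation_of_NP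
    (hNP : ∃ C : ℝ, 0 < C ∧ ∀ (F : T3Family) (K n : ℕ) (x₀ : Site (F.P K) 0)
      (f : GaugeField (F.P K) 0 (Matrix.specialUnitaryGroup (Fin 2) ℂ) → ℝ) (Λ : ℝ), 0 ≤ Λ → 1 ≤ n → 2 * n ≤ (F.P K).sitesPerDir 0 →
      GaugeField.GaugeInvariant f →
      (∀ U U' : GaugeField (F.P K) 0 (Matrix.specialUnitaryGroup (Fin 2) ℂ),
        (∀ b : PBond (F.P K) 0, (∀ k, (b.src k - x₀ k).val < n) → (∀ k, (b.tgt k - x₀ k).val < n) → U b = U' b) → f U = f U') →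
      (∀ U U' : GaugeField (F.P K) 0 (Matrix.specialUnitaryGroup (Fin 2) ℂ),
        |f U - f U'| ≤ Λ * Real.sqrt (∑ b : PBond (F.P K) 0, GaugeGroup.dist1 (U b * (U' b)⁻¹) ^ 2)) →
      ∀ U : GaugeField (F.P K) 0 (Matrix.specialUnitaryGroup (Fin 2) ℂ),
        |f U - f (fun _ => 1)| ≤ Λ * (C * (n : ℝ)) * Real.sqrt (∑ p ∈ Finset.univ.filter (fun p : Plaq (F.P K) 0 => p ∈ boxPlaqs (P := F.P K) (j := 0) (fun k => ((x₀ k).val : ℤ)) (fun k => ((x₀ k).val : ℤ) + ((n : ℤ) - 1))), GaugeGroup.dist1 (GaugeField.plaqHol U p) ^ 2)) :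
        open Literature.MathematicalPhysics.QuantumFieldTheory.Balaban1983to89 Literature.MathematicalPhysics.QuantumFieldTheory.Balaban1983to89.T3ContinuumYM3Torus in ∀ (L : ℕ), ∃ (Cth : ℝ), 0 < Cth ∧ ∃ (Cc cc : ℝ), 0 ≤ Cc ∧ 0 < cc ∧ ∃ γ₁ : ℝ, 0 < γ₁ ∧ γ₁ ≤ 1 ∧ ∀ (F : T3Family) (γ : ℝ), F.L = L → 0 < γ → γ ≤ γ₁ → ∀ (K n : ℕ), 1 ≤ n → (n : ℝ) ≤ (F.scheme T3UnitLawDensityEML.ℰp γ).β K → 2 * n ≤ (F.P K).sitesPerDir 0 → ∀ (x₀ : Site (F.P K) 0) (f : GaugeField (F.P K) 0 (Matrix.specialUnitaryGroup (Fin 2) ℂ) → ℝ) (Λ : ℝ), 0 < Λ → Measurable f → GaugeField.GaugeInvariant f → (∀ U U' : GaugeField (F.P K) 0 (Matrix.specialUnitaryGroup (Fin 2) ℂ), (∀ b : PBond (F.P K) 0, (∀ k, (b.src k - x₀ k).val < n) → (∀ k, (b.tgt k - x₀ k).val < n) → U b = U' b) → f U = f U') → (∀ U U' : GaugeField (F.P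 K) 0 (Matrix.specialUnitaryGroup (Fin 2) ℂ), |f U - f U'| ≤ Λ * Real.sqrt (∑ b : PBond (F.P K) 0, GaugeGroup.dist1 (U b * (U' b)⁻¹) ^ 2)) → ∀ r : ℝ, 0 ≤ r → Cth * Λ ^ 2 * (n : ℝ) ^ 5 ≤ (F.scheme T3UnitLawDensityEML.ℰp γ).β K * r ^ 2 → (T3UnitScaleTilt.gibbsK F T3UnitLawDensityEML.ℰp γ K).real {U | r ≤ f U - ∫ V, f V ∂(T3UnitScaleTilt.gibbsK F T3UnitLawDensityEML.ℰp γ K)} ≤ Cc * Real.exp (-(cc * (F.scheme T3UnitLawDensityEML.ℰp γ).β K * r ^ 2 / ((n : ℝ) ^ 2 * Λ ^ 2))) :=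
  largeDeviation_of hNP
    Summit.QuantumFields.YangMills.Theorems.CurvaturePoincareStubLocalBoxExpMoment.stub_localBoxExpMoment
    Summit.QuantumFields.YangMills.Theorems.PoincareLipschitzMesoscopicConcentrationLSqrtPinnedTail.stub_sqrtPinnedTail

/-! ## §3 Regimes ⟹ the mesoscopic residual (R) ⟹ the crux BY NAME -/

/-- GLUE (regimes), port of the skeleton's `mesoscopicResidual_of`: large deviations (all `n`) `→` the moderate-deviation residual (`17L³ < n`) `→` the v1.1
mesoscopic residual statement (R) (token-identical with LINE 23's `stub_mesoscopicBoxConcentration` and with the row `hR` of ✓p740183): max/min of the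
constants, case split on `C_th·Λ²·n⁵ ≤ β_K r²`. -/
theorem mesoscopicResidual_of
    (hlarge :     open Literature.MathematicalPhysics.QuantumFieldTheory.Balaban1983to89 Literature.MathematicalPhysics.QuantumFieldTheory.Balaban1983to89.T3ContinuumYM3Torus in ∀ (L : ℕ), ∃ (Cth : ℝ), 0 < Cth ∧ ∃ (Cc cc : ℝ), 0 ≤ Cc ∧ 0 < cc ∧ ∃ γ₁ : ℝ, 0 < γ₁ ∧ γ₁ ≤ 1 ∧ ∀ (F : T3Family) (γ : ℝ), F.L = L → 0 < γ → γ ≤ γ₁ → ∀ (K n : ℕ), 1 ≤ n → (n : ℝ) ≤ (F.scheme T3UnitLawDensityEML.ℰp γ).β K → 2 * n ≤ (F.P K).sitesPerDir 0 → ∀ (x₀ : Site (F.P K) 0) (f : GaugeField (F.P K) 0 (Matrix.specialUnitaryGroup (Fin 2) ℂ) → ℝ) (Λ : ℝ), 0 < Λ → Measurable f → GaugeField.GaugeInvariant f → (∀ U U' : GaugeField (F.P K) 0 (Matrix.specialUnitaryGroup (Fin 2) ℂ), (∀ b : PBond (F.P K) 0, (∀ k, (b.src k - x₀ k).val < n)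 → (∀ k, (b.tgt k - x₀ k).val < n) → U b = U' b) → f U = f U') → (∀ U U' : GaugeField (F.P K) 0 (Matrix.specialUnitaryGroup (Fin 2) ℂ), |f U - f U'| ≤ Λ * Real.sqrt (∑ b : PBond (F.P K) 0, GaugeGroup.dist1 (U b * (U' b)⁻¹) ^ 2)) → ∀ r : ℝ, 0 ≤ r → Cth * Λ ^ 2 * (n : ℝ) ^ 5 ≤ (F.scheme T3UnitLawDensityEML.ℰp γ).β K * r ^ 2 → (T3UnitScaleTilt.gibbsK F T3UnitLawDensityEML.ℰp γ K).real {U | r ≤ f U - ∫ V, f V ∂(T3UnitScaleTilt.gibbsK F T3UnitLawDensityEML.ℰp γ K)} ≤ Cc * Real.exp (-(cc * (F.scheme T3UnitLawDensityEML.ℰp γ).β K * r ^ 2 / ((n : ℝ) ^ 2 * Λ ^ 2))))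
    (hmod :     open Literature.MathematicalPhysics.QuantumFieldTheory.Balaban1983to89 Literature.MathematicalPhysics.QuantumFieldTheory.Balaban1983to89.T3ContinuumYM3Torus in ∀ (L : ℕ) (Cth : ℝ), 0 < Cth → ∃ (Cc cc : ℝ), 0 ≤ Cc ∧ 0 < cc ∧ ∃ γ₁ : ℝ, 0 < γ₁ ∧ γ₁ ≤ 1 ∧ ∀ (F : T3Family) (γ : ℝ), F.L = L → 0 < γ → γ ≤ γ₁ → ∀ (K n : ℕ), 1 ≤ n → (n : ℝ) ≤ (F.scheme T3UnitLawDensityEML.ℰp γ).β K → 2 * n ≤ (F.P K).sitesPerDir 0 → 17 * L ^ 3 < n → ∀ (x₀ : Site (F.P K) 0) (f : GaugeField (F.P K) 0 (Matrix.specialUnitaryGroup (Fin 2) ℂ) → ℝ) (Λ : ℝ), 0 < Λ → Measurable f → GaugeField.GaugeInvariant f → (∀ U U' : GaugeField (F.P K) 0 (Matrix.specialUnitaryGroup (Fin 2) ℂ), (∀ b : PBond (F.P K) 0, (∀ k, (b.src k - x₀ k).val < n) → (∀ k, (b.tgt k - x₀ k).val < n) → U b = U' b) → f U = f U') → (∀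 U U' : GaugeField (F.P K) 0 (Matrix.specialUnitaryGroup (Fin 2) ℂ), |f U - f U'| ≤ Λ * Real.sqrt (∑ b : PBond (F.P K) 0, GaugeGroup.dist1 (U b * (U' b)⁻¹) ^ 2)) → ∀ r : ℝ, 0 ≤ r → (F.scheme T3UnitLawDensityEML.ℰp γ).β K * r ^ 2 ≤ Cth * Λ ^ 2 * (n : ℝ) ^ 5 → (T3UnitScaleTilt.gibbsK F T3UnitLawDensityEML.ℰp γ K).real {U | r ≤ f U - ∫ V, f V ∂(T3UnitScaleTilt.gibbsK F T3UnitLawDensityEML.ℰp γ K)} ≤ Cc * Real.exp (-(cc * (F.scheme T3UnitLawDensityEML.ℰp γ).β K * r ^ 2 / ((n : ℝ) ^ 2 * Λ ^ 2)))) :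
        open Literature.MathematicalPhysics.QuantumFieldTheory.Balaban1983to89 Literature.MathematicalPhysics.QuantumFieldTheory.Balaban1983to89.T3ContinuumYM3Torus in ∀ (L : ℕ), ∃ (Cc cc : ℝ), 0 ≤ Cc ∧ 0 < cc ∧ ∃ γ₁ : ℝ, 0 < γ₁ ∧ γ₁ ≤ 1 ∧ ∀ (F : T3Family) (γ : ℝ), F.L = L → 0 < γ → γ ≤ γ₁ → ∀ (K n : ℕ), 1 ≤ n → (n : ℝ) ≤ (F.scheme T3UnitLawDensityEML.ℰp γ).β K → 2 * n ≤ (F.P K).sitesPerDir 0 → 17 * L ^ 3 < n → ∀ (x₀ : Site (F.P K) 0) (f : GaugeField (F.P K) 0 (Matrix.specialUnitaryGroup (Fin 2) ℂ) → ℝ) (Λ : ℝ), 0 < Λ → Measurable f → GaugeField.GaugeInvariant f → (∀ U U' : GaugeField (F.P K) 0 (Matrix.specialUnitaryGroup (Fin 2) ℂ), (∀ b : PBond (F.P K) 0, (∀ k, (b.src k - x₀ k).val < n) → (∀ k, (b.tgt k - x₀ k).val < n) → U b = U' b) → f U = f U') → (∀ U U' : GaugeField (F.P K) 0 (Matrix.specialUnitaryGroup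 (Fin 2) ℂ), |f U - f U'| ≤ Λ * Real.sqrt (∑ b : PBond (F.P K) 0, GaugeGroup.dist1 (U b * (U' b)⁻¹) ^ 2)) → ∀ r : ℝ, 0 ≤ r → (T3UnitScaleTilt.gibbsK F T3UnitLawDensityEML.ℰp γ K).real {U | r ≤ f U - ∫ V, f V ∂(T3UnitScaleTilt.gibbsK F T3UnitLawDensityEML.ℰp γ K)} ≤ Cc * Real.exp (-(cc * (F.scheme T3UnitLawDensityEML.ℰp γ).β K * r ^ 2 / ((n : ℝ) ^ 2 * Λ ^ 2))) := by
  intro L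
  obtain ⟨Cth, hCth, Cc₁, cc₁, hCc₁, hcc₁, γa, hγa, hγa1, H1⟩ := hlarge L
  obtain ⟨Cc₂, cc₂, hCc₂, hcc₂, γb, hγb, hγb1, H2⟩ := hmod L Cth hCth
  refine ⟨max Cc₁ Cc₂, min cc₁ cc₂, le_max_of_le_left hCc₁, lt_min hcc₁ hcc₂, min γa γb, lt_min hγa hγb,
    (min_le_left _ _).trans hγa1, ?_⟩
  intro F γ hFL hγ hγle K n hn1 hnβ h2n hnL x₀ f Λ hΛ hfm hfG hloc hlip r hr
  have hn1r : (1 : ℝ) ≤ (n : ℝ) := by exact_mod_cast hn1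
  have hβ0 : (0 : ℝ) ≤ (F.scheme ℰp γ).β K := by linarith [hn1r.trans hnβ]
  have hQ0 : 0 ≤ (F.scheme ℰp γ).β K * r ^ 2 / ((n : ℝ) ^ 2 * Λ ^ 2) := by positivity
  have hmono : ∀ (C c : ℝ), C ≤ max Cc₁ Cc₂ → min cc₁ cc₂ ≤ c →
      C * Real.exp (-(c * (F.scheme ℰp γ).β K * r ^ 2 / ((n : ℝ) ^ 2 * Λ ^ 2)))
        ≤ max Cc₁ Cc₂ * Real.exp (-(min cc₁ cc₂ * (F.scheme ℰp γ).β K * r ^ 2 / ((n : ℝ) ^ 2 * Λ ^ 2))) := by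
    intro C c hC hc
    refine mul_le_mul hC ?_ (Real.exp_pos _).le ((hCc₁.trans (le_max_left _ _)))
    rw [Real.exp_le_exp, neg_le_neg_iff]
    have e1 : min cc₁ cc₂ * (F.scheme ℰp γ).β K * r ^ 2 / ((n : ℝ) ^ 2 * Λ ^ 2)
        = min cc₁ cc₂ * ((F.scheme ℰp γ).β K * r ^ 2 / ((n : ℝ) ^ 2 * Λ ^ 2)) := by ring
    have e2 : c * (F.scheme ℰp γ).β K * r ^ 2 / ((n : ℝ) ^ 2 * Λ ^ 2)
        = c * ((F.scheme ℰp γ).β K * r ^ 2 / ((n : ℝ) ^ 2 * Λ ^ 2)) := by ring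
    rw [e1, e2]
    exact mul_le_mul_of_nonneg_right hc hQ0
  by_cases hreg : Cth * Λ ^ 2 * (n : ℝ) ^ 5 ≤ (F.scheme ℰp γ).β K * r ^ 2
  · exact (H1 F γ hFL hγ (hγle.trans (min_le_left _ _)) K n hn1 hnβ h2n x₀ f Λ hΛ hfm hfG hloc hlip r hr hreg).trans
      (hmono Cc₁ cc₁ (le_max_left _ _) (min_le_left _ _))
  · exact (H2 F γ hFL hγ (hγle.trans (min_le_right _ _)) K n hn1 hnβ h2n hnL x₀ f Λ hΛ hfm hfG hloc hlip r hr (not_le.mp hreg).le).trans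
      (hmono Cc₂ cc₂ (le_max_right _ _) (min_le_right _ _))

open Classical in
/-- ★ **THE K1 FACE OVER LINE 30: `PoincareLipschitz.MesoscopicConcentrationL` (stmt-QuantumFields-23532) BY NAME from the two ACTIVE registered stubs of
LINE 30 only — NP `stub_curvaturePinning` (`hNP`) and the Gaussian window MD `stub_moderateDeviationResidual` (`hMD`), both displayed VERBATIM;** LM, B♯
and the bounded-box rung are discharged in-tree (✓p740923, ✓p740627, ✓`PoincareLipschitzStubBoundedBoxConcentration` via ✓p740183).
[cite: Balaban1985UV3, (3) p.256, (7) p.257] -/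
theorem mesoscopicConcentrationL_of_NP_MD
    (hNP : ∃ C : ℝ, 0 < C ∧ ∀ (F : T3Family) (K n : ℕ) (x₀ : Site (F.P K) 0)
      (f : GaugeField (F.P K) 0 (Matrix.specialUnitaryGroup (Fin 2) ℂ) → ℝ) (Λ : ℝ), 0 ≤ Λ → 1 ≤ n → 2 * n ≤ (F.P K).sitesPerDir 0 →
      GaugeField.GaugeInvariant f →
      (∀ U U' : GaugeField (F.P K) 0 (Matrix.specialUnitaryGroup (Fin 2) ℂ),
        (∀ b : PBond (F.P K) 0, (∀ k, (b.src k - x₀ k).val < n) → (∀ k, (b.tgt k - x₀ k).val < n) → U b = U' b) → f U = f U') →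
      (∀ U U' : GaugeField (F.P K) 0 (Matrix.specialUnitaryGroup (Fin 2) ℂ),
        |f U - f U'| ≤ Λ * Real.sqrt (∑ b : PBond (F.P K) 0, GaugeGroup.dist1 (U b * (U' b)⁻¹) ^ 2)) →
      ∀ U : GaugeField (F.P K) 0 (Matrix.specialUnitaryGroup (Fin 2) ℂ),
        |f U - f (fun _ => 1)| ≤ Λ * (C * (n : ℝ)) * Real.sqrt (∑ p ∈ Finset.univ.filter (fun p : Plaq (F.P K) 0 => p ∈ boxPlaqs (P := F.P K) (j := 0) (fun k => ((x₀ k).val : ℤ)) (fun k => ((x₀ k).val : ℤ) + ((n : ℤ) - 1))), GaugeGroup.dist1 (GaugeField.plaqHol U p) ^ 2))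
    (hMD : open Literature.MathematicalPhysics.QuantumFieldTheory.Balaban1983to89 Literature.MathematicalPhysics.QuantumFieldTheory.Balaban1983to89.T3ContinuumYM3Torus in ∀ (L : ℕ) (Cth : ℝ), 0 < Cth → ∃ (Cc cc : ℝ), 0 ≤ Cc ∧ 0 < cc ∧ ∃ γ₁ : ℝ, 0 < γ₁ ∧ γ₁ ≤ 1 ∧ ∀ (F : T3Family) (γ : ℝ), F.L = L → 0 < γ → γ ≤ γ₁ → ∀ (K n : ℕ), 1 ≤ n → (n : ℝ) ≤ (F.scheme T3UnitLawDensityEML.ℰp γ).β K → 2 * n ≤ (F.P K).sitesPerDir 0 → 17 * L ^ 3 < n → ∀ (x₀ : Site (F.P K) 0) (f : GaugeField (F.P K) 0 (Matrix.specialUnitaryGroup (Fin 2) ℂ) → ℝ) (Λ : ℝ), 0 < Λ → Measurable f → GaugeField.GaugeInvariant f → (∀ U U' : GaugeField (F.P K) 0 (Matrix.specialUnitaryGroup (Fin 2) ℂ), (∀ b : PBond (F.P K) 0, (∀ k, (b.src k - x₀ k).val < n) → (∀ k, (b.tgt k - x₀ k).val < n) → U b = U' b) → f U = f U') → (∀ U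 U' : GaugeField (F.P K) 0 (Matrix.specialUnitaryGroup (Fin 2) ℂ), |f U - f U'| ≤ Λ * Real.sqrt (∑ b : PBond (F.P K) 0, GaugeGroup.dist1 (U b * (U' b)⁻¹) ^ 2)) → ∀ r : ℝ, 0 ≤ r → (F.scheme T3UnitLawDensityEML.ℰp γ).β K * r ^ 2 ≤ Cth * Λ ^ 2 * (n : ℝ) ^ 5 → (T3UnitScaleTilt.gibbsK F T3UnitLawDensityEML.ℰp γ K).real {U | r ≤ f U - ∫ V, f V ∂(T3UnitScaleTilt.gibbsK F T3UnitLawDensityEML.ℰp γ K)} ≤ Cc * Real.exp (-(cc * (F.scheme T3UnitLawDensityEML.ℰp γ).β K * r ^ 2 / ((n : ℝ) ^ 2 * Λ ^ 2)))) :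
    Summit.QuantumFields.YangMills.Theses.PoincareLipschitz.MesoscopicConcentrationL :=
  Summit.QuantumFields.YangMills.Theorems.PoincareLipschitzMesoscopicConcentrationLOfMesoscopicBox.mesoscopicConcentrationL_of_mesoscopicBox
    (mesoscopicResidual_of (largeDeviation_of_NP hNP) hMD)

end Summit.QuantumFields.YangMills.Theorems.CurvaturePoincareLargeDeviationOfStubs
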